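import Mathlib
import Summits.Ventures.PercRepro2.Defs
import Summits.Ventures.PercRepro2.Independence
import Summits.Ventures.PercRepro2.Harris
import Summits.Ventures.PercRepro2.Graph
import Summits.Ventures.PercRepro2.Exploration
import Summits.Ventures.PercRepro2.Events
import Summits.Ventures.PercRepro2.FourFunctions
import Summits.Ventures.PercRepro2.Induced
import Summits.Ventures.PercRepro2.Frontier
import Summits.Ventures.PercRepro2.ObsIndependence
import Summits.Ventures.PercRepro2.BHK
import Summits.Ventures.PercRepro2.BHKEvents
import Summits.Ventures.PercRepro2.VdBKahn
import Summits.Ventures.PercRepro2.BHKAvoid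

/-!
# The (K′) and (K″) inequalities: one explored cluster, one avoided vertex, two marks
(blind cell PercRepro2, typer-1)

A finite graph, a source `a₂`, an avoided vertex `x`, two marks `o`, `b`; `R = {a₂ ↮ x}`.
Atoms: `r = P(R)`, `a = P(a₂ ↔ o)`, `c = P(a₂ ↔ b)`, `m = P(a₂ ↔ b, a₂ ↔ o)`,
`poH = P(a₂ ↔ o, R)`, `pbH = P(a₂ ↔ b, R)`, `poL = P(x ↔ o, R)`, `pbL = P(x ↔ b, R)`,
`J_LH = P(a₂ ↔ o, x ↔ b, R)`, `J_HL = P(a₂ ↔ b, x ↔ o, R)`; blocks `η_o = r·a − poH`,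
`η_b = r·c − pbH`, `M = m − a·c`, `N = r·m − c·poH`, `sb = pbL − pbH`, and
`Γ′ = 2·[(pbL·poH − r·J_LH) + (pbH·poL − r·J_HL)]` (the `a₃`-free functional of the two-root
world, expanded on `R`: on `R` the two roots `x`, `a₂` have disjoint clusters, so
`σ_v = 1[v ↔ x] − 1[v ↔ a₂]` and `1[v ∈ U′] = 1[v ↔ x] + 1[v ↔ a₂]`, and the cross terms
`Q·S_bo − s_b·s_o − (Q·m_bo − m_o·m_b)` collapse to the two brackets).

* `K2_nonneg` — **(K″)/2 = Γ′/2 + sb·η_o + r·N ≥ 0**;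
* `K1_nonneg` — **(K′)/2 = r·(a·pbL − J_LH) + r·(c·poL − J_HL) + T ≥ 0** with
  `T = r·(M + N) − pbH·η_o`.

Proof: both are sums of nonnegative terms (`K2_algebra`, `K1_algebra`):
`(K″)/2 = (pbL·poH − r·J_LH) + (pbH·poL − r·J_HL) + pbL·η_o + r²·M + η_o·η_b`,
`(K′)/2 = (pbL·poH − r·J_LH) + (pbH·poL − r·J_HL) + pbL·η_o + poL·η_b + r·M + r²·M + η_o·η_b`,
where `r·J_LH ≤ poH·pbL` and `r·J_HL ≤ pbH·poL` are the cross-cluster BHK inequality with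
avoidance (`bhk_cross_cluster_avoid`, BHK06 Thm 1.4; `bhk_cross`), and `η_o, η_b ≥ 0`
(`harris_avoid`) and `M ≥ 0` (`harris_conn`) are Harris' inequality.
-/

namespace Summit.Ventures.PercRepro2.CutVK2

section Algebra

variable {R : Type*} [CommRing R] [LinearOrder R] [IsStrictOrderedRing R]

/-- **The algebra of (K″)**. -/
lemma K2_algebra {r a c m poH pbH poL pbL JLH JHL : R} (hr : 0 ≤ r) (hpbL : 0 ≤ pbL)
    (sB : JLH * r ≤ poH * pbL) (sA : JHL * r ≤ pbH * poL) (ho : poH ≤ r * a)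
    (hb : pbH ≤ r * c) (hM : c * a ≤ m) :
    0 ≤ (pbL * poH - r * JLH) + (pbH * poL - r * JHL) + (pbL - pbH) * (r * a - poH) +
      r * (r * m - c * poH) := by
  have e : (pbL * poH - r * JLH) + (pbH * poL - r * JHL) + (pbL - pbH) * (r * a - poH) +
      r * (r * m - c * poH) =
      (poH * pbL - JLH * r) + (pbH * poL - JHL * r) + pbL * (r * a - poH) +
        (r * r) * (m - c * a) + (r * a - poH) * (r * c - pbH) := by ring
  rw [e]
  refine add_nonneg (add_nonneg (add_nonneg (add_nonneg ?_ ?_) ?_) ?_) ?_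
  · exact sub_nonneg.2 sB
  · exact sub_nonneg.2 sA
  · exact mul_nonneg hpbL (sub_nonneg.2 ho)
  · exact mul_nonneg (mul_nonneg hr hr) (sub_nonneg.2 hM)
  · exact mul_nonneg (sub_nonneg.2 ho) (sub_nonneg.2 hb)

/-- **The algebra of (K′)**. -/
lemma K1_algebra {r a c m poH pbH poL pbL JLH JHL : R} (hr : 0 ≤ r) (hpbL : 0 ≤ pbL)
    (hpoL : 0 ≤ poL) (sB : JLH * r ≤ poH * pbL) (sA : JHL * r ≤ pbH * poL) (ho : poH ≤ r * a)
    (hb : pbH ≤ r * c) (hM : c * a ≤ m) :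
    0 ≤ r * (a * pbL - JLH) + r * (c * poL - JHL) +
      (r * ((m - c * a) + (r * m - c * poH)) - pbH * (r * a - poH)) := by
  have e : r * (a * pbL - JLH) + r * (c * poL - JHL) +
      (r * ((m - c * a) + (r * m - c * poH)) - pbH * (r * a - poH)) =
      (poH * pbL - JLH * r) + (pbH * poL - JHL * r) + pbL * (r * a - poH) +
        poL * (r * c - pbH) + r * (m - c * a) + (r * r) * (m - c * a) +
        (r * a - poH) * (r * c - pbH) := by ring
  rw [e]
  refine add_nonneg (add_nonneg (add_nonneg (add_nonneg (add_nonneg (add_nonneg ?_ ?_) ?_) ?_)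
    ?_) ?_) ?_
  · exact sub_nonneg.2 sB
  · exact sub_nonneg.2 sA
  · exact mul_nonneg hpbL (sub_nonneg.2 ho)
  · exact mul_nonneg hpoL (sub_nonneg.2 hb)
  · exact mul_nonneg hr (sub_nonneg.2 hM)
  · exact mul_nonneg (mul_nonneg hr hr) (sub_nonneg.2 hM)
  · exact mul_nonneg (sub_nonneg.2 ho) (sub_nonneg.2 hb)

end Algebra

section Instances

variable {V : Type*} {E : Type*} [Fintype E] [DecidableEq E] [Fintype V] [DecidableEq V]
  {R : Type*} [CommRing R] [LinearOrder R] [IsStrictOrderedRing R]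

omit [Fintype E] [DecidableEq E] [Fintype V] [DecidableEq V] in
/-- `{a₂ ↮ x}` is a decreasing event. -/
lemma isLowerSet_avoidAll (ends : E → Sym2 V) (a₂ x : V) :
    IsLowerSet (avoidAll ends a₂ {x}) := by
  intro ω ω' h hω y hy hc
  exact hω y hy (conn_mono h hc)

omit [Fintype E] [DecidableEq E] [Fintype V] [DecidableEq V] in
/-- `{W | v ∈ W}` is an up-set. -/
lemma isUpperSet_setOf_mem (v : V) : IsUpperSet ({W | v ∈ W} : Set (Set V)) :=
  fun _ _ h hW => h hW

omit [Fintype V] [DecidableEq V] in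
/-- **Harris**: `P(a₂ ↔ u, a₂ ↮ x) ≤ P(a₂ ↮ x) · P(a₂ ↔ u)`. -/
lemma harris_avoid (p : E → R) (hp : IsProbVec p) (ends : E → Sym2 V) (x a₂ u : V) :
    prob p (connEvent ends a₂ u ∩ avoidAll ends a₂ {x}) ≤
      prob p (avoidAll ends a₂ {x}) * prob p (connEvent ends a₂ u) := by
  rw [Set.inter_comm]
  exact prob_inter_le_prob_mul_prob_of_isLowerSet hp (isLowerSet_avoidAll ends a₂ x)
    (isUpperSet_connEvent ends a₂ u)

omit [Fintype V] [DecidableEq V] in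
/-- **Harris**: `P(a₂ ↔ u) · P(a₂ ↔ v) ≤ P(a₂ ↔ u, a₂ ↔ v)`. -/
lemma harris_conn (p : E → R) (hp : IsProbVec p) (ends : E → Sym2 V) (a₂ u v : V) :
    prob p (connEvent ends a₂ u) * prob p (connEvent ends a₂ v) ≤
      prob p (connEvent ends a₂ u ∩ connEvent ends a₂ v) :=
  prob_mul_prob_le_prob_inter hp (isUpperSet_connEvent ends a₂ u) (isUpperSet_connEvent ends a₂ v)

/-- **Cross-cluster BHK with avoidance** (BHK06 Thm 1.4, `bhk_cross_cluster_avoid` with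
`s = a₂`, `t = x`, `X = {x}`): `P(a₂ ↔ u, x ↔ v, a₂ ↮ x) · P(a₂ ↮ x) ≤
P(a₂ ↔ u, a₂ ↮ x) · P(x ↔ v, a₂ ↮ x)`. -/
lemma bhk_cross (p : E → R) (hp : IsProbVec p) (ends : E → Sym2 V) (x a₂ u v : V) :
    prob p (connEvent ends a₂ u ∩ connEvent ends x v ∩ avoidAll ends a₂ {x}) *
        prob p (avoidAll ends a₂ {x}) ≤
      prob p (connEvent ends a₂ u ∩ avoidAll ends a₂ {x}) *
        prob p (connEvent ends x v ∩ avoidAll ends a₂ {x}) := by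
  have h := bhk_cross_cluster_avoid p hp ends a₂ x (Finset.mem_singleton_self x)
    (isUpperSet_setOf_mem u) (isUpperSet_setOf_mem v)
  exact h

/-- **The (K″) inequality** (MINE2-CUTVERTEX §13.9′/§13.12, `(K″) = Γ′ + 2·sb·η_o + 2·Q·N`):
`(K″)/2 = [pbL·poH − r·J_LH] + [pbH·poL − r·J_HL] + (pbL − pbH)·η_o + r·(r·m − c·poH) ≥ 0`. -/
theorem K2_nonneg (p : E → R) (hp : IsProbVec p) (ends : E → Sym2 V) (x a₂ o b : V) :
    0 ≤ (prob p (connEvent ends x b ∩ avoidAll ends a₂ {x}) *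
          prob p (connEvent ends a₂ o ∩ avoidAll ends a₂ {x}) -
        prob p (avoidAll ends a₂ {x}) *
          prob p (connEvent ends a₂ o ∩ connEvent ends x b ∩ avoidAll ends a₂ {x})) +
      (prob p (connEvent ends a₂ b ∩ avoidAll ends a₂ {x}) *
          prob p (connEvent ends x o ∩ avoidAll ends a₂ {x}) -
        prob p (avoidAll ends a₂ {x}) *
          prob p (connEvent ends a₂ b ∩ connEvent ends x o ∩ avoidAll ends a₂ {x})) +
      (prob p (connEvent ends x b ∩ avoidAll ends a₂ {x}) -
          prob p (connEvent ends a₂ b ∩ avoidAll ends a₂ {x})) *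
        (prob p (avoidAll ends a₂ {x}) * prob p (connEvent ends a₂ o) -
          prob p (connEvent ends a₂ o ∩ avoidAll ends a₂ {x})) +
      prob p (avoidAll ends a₂ {x}) *
        (prob p (avoidAll ends a₂ {x}) * prob p (connEvent ends a₂ b ∩ connEvent ends a₂ o) -
          prob p (connEvent ends a₂ b) * prob p (connEvent ends a₂ o ∩ avoidAll ends a₂ {x})) :=
  K2_algebra (prob_nonneg hp _) (prob_nonneg hp _) (bhk_cross p hp ends x a₂ o b)
    (bhk_cross p hp ends x a₂ b o) (harris_avoid p hp ends x a₂ o) (harris_avoid p hp ends x a₂ b)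
    (harris_conn p hp ends a₂ b o)

/-- **The (K′) inequality** (MINE2-CUTVERTEX §13.9′/§13.12,
`(K′)/2 = Q·[bo·pbL − J_LH] + Q·[bb·poL − J_HL] + T`, `T = Q·(M + N) − pbH·η_o`):
`(K′)/2 = r·(a·pbL − J_LH) + r·(c·poL − J_HL) + (r·((m − a·c) + (r·m − c·poH)) − pbH·η_o) ≥ 0`. -/
theorem K1_nonneg (p : E → R) (hp : IsProbVec p) (ends : E → Sym2 V) (x a₂ o b : V) :
    0 ≤ prob p (avoidAll ends a₂ {x}) *
        (prob p (connEvent ends a₂ o) * prob p (connEvent ends x b ∩ avoidAll ends a₂ {x}) -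
          prob p (connEvent ends a₂ o ∩ connEvent ends x b ∩ avoidAll ends a₂ {x})) +
      prob p (avoidAll ends a₂ {x}) *
        (prob p (connEvent ends a₂ b) * prob p (connEvent ends x o ∩ avoidAll ends a₂ {x}) -
          prob p (connEvent ends a₂ b ∩ connEvent ends x o ∩ avoidAll ends a₂ {x})) +
      (prob p (avoidAll ends a₂ {x}) *
          ((prob p (connEvent ends a₂ b ∩ connEvent ends a₂ o) -
              prob p (connEvent ends a₂ b) * prob p (connEvent ends a₂ o)) +
            (prob p (avoidAll ends a₂ {x}) * prob p (connEvent ends a₂ b ∩ connEvent ends a₂ o) -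
              prob p (connEvent ends a₂ b) * prob p (connEvent ends a₂ o ∩ avoidAll ends a₂ {x}))) -
        prob p (connEvent ends a₂ b ∩ avoidAll ends a₂ {x}) *
          (prob p (avoidAll ends a₂ {x}) * prob p (connEvent ends a₂ o) -
            prob p (connEvent ends a₂ o ∩ avoidAll ends a₂ {x}))) :=
  K1_algebra (prob_nonneg hp _) (prob_nonneg hp _) (prob_nonneg hp _)
    (bhk_cross p hp ends x a₂ o b) (bhk_cross p hp ends x a₂ b o) (harris_avoid p hp ends x a₂ o)
    (harris_avoid p hp ends x a₂ b) (harris_conn p hp ends a₂ b o)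

end Instances

end Summit.Ventures.PercRepro2.CutVK2
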